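import Literature.Geometry.Lorentzian.VolumeSmallBalls
import Literature.Geometry.Riemannian.CanonicalNeighbourhoodsProofs
import Literature.Geometry.Riemannian.KarpukhinSternAssembly
import Literature.Geometry.Riemannian.KarpukhinSternLemma36
import HarnessLib

/-!
# Karpukhin–Stern: the named fact from Theorem 3.2, energy monotonicity and the energy gap;
# Euclidean volume growth of small geodesic balls
(seventh proof file of `KarpukhinSternHarmonicMaps.lean`; topic `Geometry/Riemannian`)

Final reduction of `Literature.Geometry.Riemannian.karpukhinStern_groundStateHarmonicMap`
(Karpukhin–Stern 2024, Cor. 1.3 with Thm. 1.5) to the three inputs of the printed proof that are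
not formalised in this tree:

* `karpukhinStern_groundStateHarmonicMap_of_thm32_of_monotonicity_of_gap` — the fact follows from
  (`h32`) KS **Theorem 3.2** (p. 745: for `3 ≤ n ≤ 5` and all large `k`, a nonconstant smooth
  harmonic `u : M → Sᵏ` with `ind_E(u) ≤ k + 1` — the min–max maps of §2), (`hmono`) the **energy
  monotonicity inequality** for smooth harmonic maps into spheres on small geodesic balls (p. 751:
  "`∫_{B_{2δ}(p)} |du|² ⩽ C(M) δ^{n−2} ∫_M |du|²` … by the well-known energy-monotonicity
  properties of stationary harmonic maps") and (`hgap`) the **energy gap** of Prop. 5.5 (p. 773: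
  `E(u) ⩾ β(M) > 0` for every nonconstant harmonic `u : M → Sᵏ`, `β` independent of `k`).
  Everything else of the 66-page proof is proved in the sibling files: `KarpukhinSternAssembly.lean`
  (the chain Lemma 3.6 ⇒ Lemma 3.7 ⇒ Prop. 3.8 ⇒ Thm. 4.6 endgame) and `KarpukhinSternLemma36.lean`
  (Lemma 3.6 from monotonicity, the gap and volume growth).
* `exists_nhds_hausdorffMeasure_eball_le_mul_pow`, `exists_hausdorffMeasure_eball_le_mul_pow_of_isCompact`,
  `exists_vol_ball_le_mul_pow` — **small geodesic balls have volume at most `C · rⁿ`**, locally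
  uniformly and uniformly on a closed manifold (the upper companion of `VolumeSmallBalls.lean`:
  charts are locally bi-Lipschitz for the length distance, Burago–Burago–Ivanov 2001, §5.1; the
  inverse chart expands `μH[n]` by at most `Kⁿ`, Federer 1969, §2.10.11; Haar scaling in the model
  space) — hypothesis `hvol` of `karpukhinStern_lemma36_of_monotonicity_of_gap`.

Everything is proved; no definitions, no named facts.

## References

* M. Karpukhin, D. Stern, *Existence of harmonic maps and eigenvalue optimization in higher
  dimensions*, Invent. Math. 236 (2024) 713–778: Thm. 3.2 (p. 745), Lemma 3.6 (pp. 750–751),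
  Prop. 5.5 (p. 773). [KarpukhinStern2024]
* H. Federer, *Geometric Measure Theory*, Springer 1969, §2.10.11. [Federer1969]
* D. Burago, Yu. Burago, S. Ivanov, *A course in metric geometry*, AMS 2001, §5.1.
-/

noncomputable section

open Manifold Bundle MeasureTheory Measure Set Filter Metric Module
open scoped ContDiff Topology ENNReal NNReal

namespace Literature.Geometry.Riemannian

namespace KarpukhinStern

open Lorentzian

section Hausdorff

variable {E : Type*} [NormedAddCommGroup E] [NormedSpace ℝ E]
  {H : Type*} [TopologicalSpace H] {I : ModelWithCorners ℝ E H}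
  {M : Type*} [TopologicalSpace M] [ChartedSpace H M]
  [RiemannianBundle (fun x : M ↦ TangentSpace I x)]
  [IsManifold I 1 M] [IsContinuousRiemannianBundle E (fun x : M ↦ TangentSpace I x)]

/-- **Small length balls have Hausdorff measure at most `c · rⁿ`, locally uniformly** (the upper
companion of `exists_nhds_mul_pow_le_hausdorffMeasure_eball`, `VolumeSmallBalls.lean`): charts
are locally bi-Lipschitz for the length distance, a small length ball `B(p, r)` lies in a chart
neighbourhood and its chart image in the norm ball `B(φ p, K₁ r)`, whose `μH[n]` is
`(K₁ r)ⁿ μH[n](B(0,1))`; the inverse chart expands `μH[n]` by at most `K₂ⁿ` (Federer 1969,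
§2.10.11). [folklore] -/
theorem exists_nhds_hausdorffMeasure_eball_le_mul_pow [T3Space M] [MeasurableSpace M]
    [BorelSpace M] [I.Boundaryless] [FiniteDimensional ℝ E] (x : M) :
    letI := EMetricSpace.ofRiemannianMetric I M
    ∃ c : ℝ≥0, ∃ ρ : ℝ, 0 < ρ ∧ ∃ V ∈ 𝓝 x, ∀ p ∈ V, ∀ r : ℝ, 0 < r → r ≤ ρ →
      μH[finrank ℝ E] (Metric.eball p (ENNReal.ofReal r)) ≤
        (c : ℝ≥0∞) * ENNReal.ofReal (r ^ finrank ℝ E) := by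
  letI := EMetricSpace.ofRiemannianMetric I M
  letI : MeasurableSpace E := borel E
  haveI : BorelSpace E := ⟨rfl⟩
  obtain ⟨C₁, s₁, hs₁, h₁⟩ := exists_enorm_extChartAt_sub_le_mul_riemannianEDist (I := I) x
  obtain ⟨C₂, s₂, hs₂, hs₂src, -, h₂⟩ := exists_riemannianEDist_le_mul_edist_extChartAt (I := I) x
  set φ := extChartAt I x with hφ
  set K₁ : ℝ≥0 := max C₁ 1 with hK₁
  set K₂ : ℝ≥0 := max C₂ 1 with hK₂
  have hK₁1 : (1 : ℝ≥0) ≤ K₁ := le_max_right _ _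
  have hK₂1 : (1 : ℝ≥0) ≤ K₂ := le_max_right _ _
  have hK₁0 : (0 : ℝ) < K₁ := by exact_mod_cast zero_lt_one.trans_le hK₁1
  have hK₁ne : (K₁ : ℝ≥0∞) ≠ 0 := by exact_mod_cast (zero_lt_one.trans_le hK₁1).ne'
  set s := s₁ ∩ s₂ with hs_def
  have hs : s ∈ 𝓝 x := inter_mem hs₁ hs₂
  have hssrc : s ⊆ φ.source := fun y hy ↦ hs₂src hy.2
  have h₁' : ∀ y ∈ s, ∀ z ∈ s, edist (φ y) (φ z) ≤ K₁ * edist y z := by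
    intro y hy z hz
    rw [edist_eq_enorm_sub]
    calc ‖φ y - φ z‖ₑ ≤ C₁ * riemannianEDist I y z := h₁ y hy.1 z hz.1
      _ ≤ K₁ * riemannianEDist I y z := by gcongr; exact le_max_left _ _
  have h₂' : ∀ y ∈ s, ∀ z ∈ s, edist y z ≤ K₂ * edist (φ y) (φ z) := by
    intro y hy z hz
    calc edist y z = riemannianEDist I y z := rfl
      _ ≤ C₂ * edist (φ y) (φ z) := h₂ y hy.2 z hz.2
      _ ≤ K₂ * edist (φ y) (φ z) := by gcongr; exact le_max_left _ _
  -- a length ball around `x` inside `s`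
  obtain ⟨ε, hε, hεs⟩ := EMetric.mem_nhds_iff.1 hs
  obtain ⟨ρ₀, hρ₀, hρ₀ε⟩ : ∃ ρ₀ : ℝ, 0 < ρ₀ ∧ ENNReal.ofReal (2 * ρ₀) ≤ ε := by
    rcases eq_or_ne ε ⊤ with htop | htop
    · exact ⟨1, one_pos, htop ▸ le_top⟩
    · refine ⟨ε.toReal / 2, by positivity [ENNReal.toReal_pos hε.ne' htop], ?_⟩
      rw [mul_div_cancel₀ _ (two_ne_zero)]
      exact ENNReal.ofReal_toReal_le
  set V : Set M := Metric.eball x (ENNReal.ofReal ρ₀) with hV_def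
  have hV : V ∈ 𝓝 x := Metric.eball_mem_nhds x (ENNReal.ofReal_pos.2 hρ₀)
  -- the Haar constant of the model space
  set w : ℝ≥0∞ := μH[finrank ℝ E] (ball (0 : E) 1) with hw_def
  have hwt : w ≠ ⊤ :=
    (measure_ball_lt_top (μ := (μH[finrank ℝ E] : Measure E)) (x := (0 : E)) (r := 1)).ne
  refine ⟨(K₂ * K₁) ^ finrank ℝ E * w.toNNReal, ρ₀, hρ₀, V, hV, fun p hp r hr hrρ ↦ ?_⟩
  -- the ball `B(p, r)` lies in `s`
  have hps : ∀ y ∈ Metric.eball p (ENNReal.ofReal r), y ∈ s := by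
    intro y hy
    apply hεs
    rw [Metric.mem_eball] at hy ⊢
    have hpx : edist p x < ENNReal.ofReal ρ₀ := hp
    calc edist y x ≤ edist y p + edist p x := edist_triangle _ _ _
      _ < ENNReal.ofReal r + ENNReal.ofReal ρ₀ := ENNReal.add_lt_add hy hpx
      _ ≤ ENNReal.ofReal (2 * ρ₀) := by
          rw [← ENNReal.ofReal_add hr.le hρ₀.le]
          exact ENNReal.ofReal_le_ofReal (by linarith)
      _ ≤ ε := hρ₀ε
  have hpmem : p ∈ s := hps p (Metric.mem_eball_self (ENNReal.ofReal_pos.2 hr))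
  -- `φ⁻¹` is `K₂`-Lipschitz on `φ '' s`
  have hL₂ : LipschitzOnWith K₂ φ.symm (φ '' s) := by
    rintro _ ⟨y, hy, rfl⟩ _ ⟨z, hz, rfl⟩
    rw [φ.left_inv (hssrc hy), φ.left_inv (hssrc hz)]
    exact h₂' y hy z hz
  have hsub : Metric.eball p (ENNReal.ofReal r) ⊆ φ.symm '' (φ '' Metric.eball p (ENNReal.ofReal r)) :=
    fun y hy ↦ ⟨φ y, mem_image_of_mem φ hy, φ.left_inv (hssrc (hps y hy))⟩
  -- the chart image lies in the norm ball `B(φ p, K₁ r)`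
  have himg : φ '' Metric.eball p (ENNReal.ofReal r) ⊆ ball (φ p) (K₁ * r) := by
    rintro _ ⟨y, hy, rfl⟩
    rw [mem_ball, dist_edist, edist_comm]
    have hfin : edist (φ p) (φ y) ≠ ⊤ := edist_ne_top _ _
    have hlt : edist (φ p) (φ y) < ENNReal.ofReal (K₁ * r) := by
      calc edist (φ p) (φ y) ≤ K₁ * edist p y := h₁' p hpmem y (hps y hy)
        _ < K₁ * ENNReal.ofReal r := by
            refine ENNReal.mul_lt_mul_right hK₁ne ENNReal.coe_ne_top ?_
            rw [edist_comm]; exact hy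
        _ = ENNReal.ofReal (K₁ * r) := by
            rw [← ENNReal.ofReal_coe_nnreal, ← ENNReal.ofReal_mul NNReal.zero_le_coe]
    exact ((ENNReal.toReal_lt_toReal hfin ENNReal.ofReal_ne_top).2 hlt).trans_eq
      (ENNReal.toReal_ofReal (by positivity))
  have hHaar : μH[finrank ℝ E] (ball (φ p) (K₁ * r)) = ENNReal.ofReal ((K₁ * r) ^ finrank ℝ E) * w :=
    addHaar_ball_of_pos _ _ (by positivity)
  have hd : (0 : ℝ) ≤ (finrank ℝ E : ℝ) := Nat.cast_nonneg _
  calc μH[finrank ℝ E] (Metric.eball p (ENNReal.ofReal r))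
      ≤ μH[finrank ℝ E] (φ.symm '' (φ '' Metric.eball p (ENNReal.ofReal r))) := measure_mono hsub
    _ ≤ (K₂ : ℝ≥0∞) ^ (finrank ℝ E : ℝ) * μH[finrank ℝ E] (φ '' Metric.eball p (ENNReal.ofReal r)) :=
        (hL₂.mono (image_mono fun y hy ↦ hps y hy)).hausdorffMeasure_image_le hd
    _ ≤ (K₂ : ℝ≥0∞) ^ (finrank ℝ E : ℝ) * μH[finrank ℝ E] (ball (φ p) (K₁ * r)) := by
        gcongr
    _ = (K₂ : ℝ≥0∞) ^ finrank ℝ E * (ENNReal.ofReal ((K₁ * r) ^ finrank ℝ E) * w) := by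
        rw [ENNReal.rpow_natCast, hHaar]
    _ = (((K₂ * K₁) ^ finrank ℝ E * w.toNNReal : ℝ≥0) : ℝ≥0∞) * ENNReal.ofReal (r ^ finrank ℝ E) := by
        rw [mul_pow, ENNReal.ofReal_mul (pow_nonneg NNReal.zero_le_coe _),
          ENNReal.ofReal_pow NNReal.zero_le_coe, ENNReal.ofReal_coe_nnreal, ENNReal.coe_mul,
          ENNReal.coe_pow, ENNReal.coe_mul, ENNReal.coe_toNNReal hwt]
        ring

/-- **Uniform upper volume bound for small balls centred on a compact set**: for compact `K`
there are `c` and `ρ > 0` with `μH[n](B(p, r)) ≤ c · rⁿ` for all `p ∈ K`, `0 < r ≤ ρ`. [folklore] -/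
theorem exists_hausdorffMeasure_eball_le_mul_pow_of_isCompact [T3Space M] [MeasurableSpace M]
    [BorelSpace M] [I.Boundaryless] [FiniteDimensional ℝ E] {K : Set M} (hK : IsCompact K) :
    letI := EMetricSpace.ofRiemannianMetric I M
    ∃ c : ℝ≥0, ∃ ρ : ℝ, 0 < ρ ∧ ∀ p ∈ K, ∀ r : ℝ, 0 < r → r ≤ ρ →
      μH[finrank ℝ E] (Metric.eball p (ENNReal.ofReal r)) ≤
        (c : ℝ≥0∞) * ENNReal.ofReal (r ^ finrank ℝ E) := by
  letI := EMetricSpace.ofRiemannianMetric I M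
  refine hK.induction_on (p := fun A ↦ ∃ c : ℝ≥0, ∃ ρ : ℝ, 0 < ρ ∧ ∀ p ∈ A,
    ∀ r : ℝ, 0 < r → r ≤ ρ → μH[finrank ℝ E] (Metric.eball p (ENNReal.ofReal r)) ≤
      (c : ℝ≥0∞) * ENNReal.ofReal (r ^ finrank ℝ E)) ?_ ?_ ?_ ?_
  · exact ⟨1, 1, one_pos, fun p hp ↦ hp.elim⟩
  · intro s t hst ht
    obtain ⟨c, ρ, hρ, h⟩ := ht
    exact ⟨c, ρ, hρ, fun p hp ↦ h p (hst hp)⟩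
  · intro s t hs ht
    obtain ⟨c, ρ, hρ, h⟩ := hs
    obtain ⟨c', ρ', hρ', h'⟩ := ht
    refine ⟨max c c', min ρ ρ', lt_min hρ hρ', fun p hp r hr hrρ ↦ ?_⟩
    rcases hp with hp | hp
    · calc μH[finrank ℝ E] (Metric.eball p (ENNReal.ofReal r))
          ≤ (c : ℝ≥0∞) * ENNReal.ofReal (r ^ finrank ℝ E) := h p hp r hr (hrρ.trans (min_le_left _ _))
        _ ≤ ((max c c' : ℝ≥0) : ℝ≥0∞) * ENNReal.ofReal (r ^ finrank ℝ E) := by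
            gcongr; exact le_max_left _ _
    · calc μH[finrank ℝ E] (Metric.eball p (ENNReal.ofReal r))
          ≤ (c' : ℝ≥0∞) * ENNReal.ofReal (r ^ finrank ℝ E) := h' p hp r hr (hrρ.trans (min_le_right _ _))
        _ ≤ ((max c c' : ℝ≥0) : ℝ≥0∞) * ENNReal.ofReal (r ^ finrank ℝ E) := by
            gcongr; exact le_max_right _ _
  · intro x _
    obtain ⟨c, ρ, hρ, V, hV, h⟩ := exists_nhds_hausdorffMeasure_eball_le_mul_pow (I := I) x
    exact ⟨V, mem_nhdsWithin_of_mem_nhds hV, c, ρ, hρ, h⟩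

end Hausdorff

section Transfer

open Lorentzian.PseudoRiemannianMetric

variable {m : ℕ} {H' : Type*} [TopologicalSpace H']
  {J : ModelWithCorners ℝ (EuclideanSpace ℝ (Fin m)) H'} [J.Boundaryless]
  {N : Type*} [TopologicalSpace N] [ChartedSpace H' N] [IsManifold J ∞ N] [CompactSpace N]
  [T3Space N] [MeasurableSpace N] [BorelSpace N]
  (h : ContMDiffRiemannianMetric J ∞ (EuclideanSpace ℝ (Fin m)) (TangentSpace J : N → Type _))

/-- **Euclidean volume growth of small geodesic balls on a closed Riemannian manifold**: there
are `C_v` and `s₀ > 0` with `Vol_h(B(p, s)) ≤ C_v sᵐ` for all `p` and all `0 < s ≤ s₀` (balls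
of the Riemannian distance, `PseudoRiemannianMetric.ball` of `ofRiemannian h`; volume
`riemannianMeasure h`). Hypothesis `hvol` of `karpukhinStern_lemma36_of_monotonicity_of_gap`.
[folklore] -/
theorem exists_vol_ball_le_mul_pow :
    ∃ Cv s₀ : ℝ, 0 < s₀ ∧ ∀ (p : N) (s : ℝ), 0 < s → s ≤ s₀ →
      (riemannianMeasure h ((ofRiemannian h).ball p (ENNReal.ofReal s))).toReal ≤ Cv * s ^ m := by
  letI : RiemannianBundle (fun x : N ↦ TangentSpace J x) :=
    ⟨h.toContinuousRiemannianMetric.toRiemannianMetric⟩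
  letI := EMetricSpace.ofRiemannianMetric J N
  obtain ⟨c, ρ, hρ, hle⟩ :=
    exists_hausdorffMeasure_eball_le_mul_pow_of_isCompact (I := J) (isCompact_univ (X := N))
  rw [finrank_euclideanSpace_fin] at hle
  set σ : ℝ≥0 := addHaarScalarFactor (volume : Measure (EuclideanSpace ℝ (Fin m)))
    (μH[m] : Measure (EuclideanSpace ℝ (Fin m))) with hσ
  refine ⟨(σ : ℝ) * c, ρ, hρ, fun p s hs hsρ ↦ ?_⟩
  have hgR : (ofRiemannian h).IsRiemannian := isRiemannian_ofRiemannian h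
  have hball : (ofRiemannian h).ball p (ENNReal.ofReal s) = Metric.eball p (ENNReal.ofReal s) := by
    rw [PseudoRiemannianMetric.ball_eq_setOf_riemannianEDist_lt hgR]
    ext y
    rw [Metric.mem_eball']
    rfl
  have hmeas : riemannianMeasure h = riemannianVolume h m := riemannianMeasure_eq_riemannianVolume h
  have hvol : riemannianMeasure h ((ofRiemannian h).ball p (ENNReal.ofReal s)) =
      (σ : ℝ≥0∞) * μH[m] (Metric.eball p (ENNReal.ofReal s)) := by
    rw [hmeas, hball]
    show (μHE[m] : Measure N) _ = _
    rw [Measure.euclideanHausdorffMeasure_def, Measure.smul_apply, ENNReal.smul_def, smul_eq_mul]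
  have hbound := hle p (mem_univ p) s hs hsρ
  have hfin : (σ : ℝ≥0∞) * ((c : ℝ≥0∞) * ENNReal.ofReal (s ^ m)) ≠ ⊤ :=
    ENNReal.mul_ne_top ENNReal.coe_ne_top (ENNReal.mul_ne_top ENNReal.coe_ne_top ENNReal.ofReal_ne_top)
  calc (riemannianMeasure h ((ofRiemannian h).ball p (ENNReal.ofReal s))).toReal
      = ((σ : ℝ≥0∞) * μH[m] (Metric.eball p (ENNReal.ofReal s))).toReal := by rw [hvol]
    _ ≤ ((σ : ℝ≥0∞) * ((c : ℝ≥0∞) * ENNReal.ofReal (s ^ m))).toReal :=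
        ENNReal.toReal_mono hfin (mul_le_mul' le_rfl hbound)
    _ = (σ : ℝ) * c * s ^ m := by
        rw [ENNReal.toReal_mul, ENNReal.toReal_mul, ENNReal.coe_toReal, ENNReal.coe_toReal,
          ENNReal.toReal_ofReal (pow_nonneg hs.le _), mul_assoc]

end Transfer

section AssemblyV2

open Lorentzian.PseudoRiemannianMetric

/-- **The named fact from KS Theorem 3.2, the energy monotonicity inequality and the energy gap
(Prop. 5.5).** Refines `karpukhinStern_groundStateHarmonicMap_of_thm32_of_lemma36`: its
hypothesis Lemma 3.6 is supplied by `karpukhinStern_lemma36_of_monotonicity_of_gap` with the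
volume growth `exists_vol_ball_le_mul_pow`, so that the remaining inputs of the printed proof are
`h32` = KS Thm. 3.2 (p. 745, existence of the min–max harmonic maps with `ind_E ≤ k + 1`),
`hmono` = the energy monotonicity inequality for smooth harmonic maps into spheres on small balls
(p. 751, "`∫_{B_{2δ}(p)} |du|² ⩽ C(M) δ^{n−2} ∫_M |du|²`") and `hgap` = the energy gap of
Prop. 5.5 (p. 773). [cite: KarpukhinStern2024, Cor. 1.3, Thm. 1.5, Thm. 3.2 p. 745, Lemma 3.6 pp. 750–751, Prop. 5.5 p. 773] -/
theorem karpukhinStern_groundStateHarmonicMap_of_thm32_of_monotonicity_of_gap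
    (h32 : ∀ (n : ℕ), 3 ≤ n → n ≤ 5 →
      ∀ (M : Type) [TopologicalSpace M] [T2Space M] [SecondCountableTopology M]
        [ChartedSpace (EuclideanSpace ℝ (Fin n)) M] [IsManifold (𝓡 n) ∞ M] [CompactSpace M]
        [ConnectedSpace M] [T3Space M] [MeasurableSpace M] [BorelSpace M]
        (g : Bundle.ContMDiffRiemannianMetric (𝓡 n) ∞ (EuclideanSpace ℝ (Fin n))
          (TangentSpace (𝓡 n) : M → Type _))
        (_ : (ofRiemannian g).HasLeviCivita),
        ∃ k₁ : ℕ, ∀ k : ℕ, k₁ ≤ k →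
          ∃ (u : M → Metric.sphere (0 : EuclideanSpace ℝ (Fin (k + 1))) 1)
            (hu : ContMDiff (𝓡 n) (𝓡 k) ∞ u),
            (∃ x y : M, u x ≠ u y) ∧
            (∀ (i : Fin (k + 1)) (x : M), (ofRiemannian g).dalembertian
              (fun y ↦ (u y : EuclideanSpace ℝ (Fin (k + 1))) i) x =
                -(energyDensity g u x) * (u x : EuclideanSpace ℝ (Fin (k + 1))) i) ∧
            energyIndex g hu ≤ (k + 1 : ℕ))
    (hmono : ∀ (n : ℕ), 3 ≤ n → n ≤ 5 →
      ∀ (M : Type) [TopologicalSpace M] [T2Space M] [SecondCountableTopology M]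
        [ChartedSpace (EuclideanSpace ℝ (Fin n)) M] [IsManifold (𝓡 n) ∞ M] [CompactSpace M]
        [ConnectedSpace M] [T3Space M] [MeasurableSpace M] [BorelSpace M]
        (g : Bundle.ContMDiffRiemannianMetric (𝓡 n) ∞ (EuclideanSpace ℝ (Fin n))
          (TangentSpace (𝓡 n) : M → Type _))
        (_ : (ofRiemannian g).HasLeviCivita),
        ∃ C₁ δ₀ : ℝ, 0 < δ₀ ∧ ∀ {k : ℕ} (u : M → Metric.sphere (0 : EuclideanSpace ℝ (Fin (k + 1))) 1)
          (_hu : ContMDiff (𝓡 n) (𝓡 k) ∞ u),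
          (∀ (i : Fin (k + 1)) (x : M), (ofRiemannian g).dalembertian
            (fun y ↦ (u y : EuclideanSpace ℝ (Fin (k + 1))) i) x =
              -(energyDensity g u x) * (u x : EuclideanSpace ℝ (Fin (k + 1))) i) →
          (∃ x y : M, u x ≠ u y) → ∀ (p : M) (δ : ℝ), 0 < δ → δ ≤ δ₀ →
          ∫ x in (ofRiemannian g).ball p (ENNReal.ofReal (2 * δ)), energyDensity g u x
              ∂riemannianMeasure g ≤
            C₁ * δ ^ (n - 2) * ∫ x, energyDensity g u x ∂riemannianMeasure g)
    (hgap : ∀ (n : ℕ), 3 ≤ n → n ≤ 5 →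
      ∀ (M : Type) [TopologicalSpace M] [T2Space M] [SecondCountableTopology M]
        [ChartedSpace (EuclideanSpace ℝ (Fin n)) M] [IsManifold (𝓡 n) ∞ M] [CompactSpace M]
        [ConnectedSpace M] [T3Space M] [MeasurableSpace M] [BorelSpace M]
        (g : Bundle.ContMDiffRiemannianMetric (𝓡 n) ∞ (EuclideanSpace ℝ (Fin n))
          (TangentSpace (𝓡 n) : M → Type _))
        (_ : (ofRiemannian g).HasLeviCivita),
        ∃ β : ℝ, 0 < β ∧ ∀ {k : ℕ} (u : M → Metric.sphere (0 : EuclideanSpace ℝ (Fin (k + 1))) 1)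
          (_hu : ContMDiff (𝓡 n) (𝓡 k) ∞ u),
          (∀ (i : Fin (k + 1)) (x : M), (ofRiemannian g).dalembertian
            (fun y ↦ (u y : EuclideanSpace ℝ (Fin (k + 1))) i) x =
              -(energyDensity g u x) * (u x : EuclideanSpace ℝ (Fin (k + 1))) i) →
          (∃ x y : M, u x ≠ u y) → β ≤ ∫ x, energyDensity g u x ∂riemannianMeasure g) :
    karpukhinStern_groundStateHarmonicMap := by
  refine karpukhinStern_groundStateHarmonicMap_of_thm32_of_lemma36 h32 ?_
  intro n hn3 hn5 M _ _ _ _ _ _ _ _ _ _ g hLC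
  haveI := hLC
  obtain ⟨Cv, s₀, hs₀, hvol⟩ := exists_vol_ball_le_mul_pow g
  obtain ⟨C₁, δ₀, hδ₀, hmono'⟩ := hmono n hn3 hn5 M g hLC
  obtain ⟨β, hβ, hgap'⟩ := hgap n hn3 hn5 M g hLC
  exact karpukhinStern_lemma36_of_monotonicity_of_gap g hn3 hs₀ hvol hδ₀
    (fun u hu harm hne p δ hδ hδδ₀ ↦ hmono' u hu harm hne p δ hδ hδδ₀) hβ
    (fun u hu harm hne ↦ hgap' u hu harm hne)

end AssemblyV2

end KarpukhinStern

end Literature.Geometry.Riemannian
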